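import Mathlib
import HarnessLib
import Literature.AlgebraicGeometry.Ramification.InertiaNormalSylow

/-!
# At a non-p-closed point a tame element with fixed locus of codimension ≥ 2 always exists
# (crux `WildQuotients.WildQuotientResolution`, stub `stub_phaseZeroHighDim`; availability of tame moves, any dimension)

Crux stmt-ResolutionOfSingularities-15640 (`WildQuotientResolution`), registered stub `stub_phaseZeroHighDim`.
The all-dimensional tame layer (✓`tameMove` p819797, ✓`ToralEndState` p820081) blows up fixed loci of TAME
elements / subgroups of the inertia groups; such a centre is a genuine move only if it has codimension `≥ 2`, i.e.
if the tame element is not a PSEUDO-REFLECTION on the cotangent space. This Mathlib-only file proves that at a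
NON-p-closed point such an element always exists, by a determinant argument:

* `exists_ne_one_coprime_of_not_isPGroup`, `exists_tame_mem_closure_pElements` — a finite group which is not
  p-closed contains an element `t ≠ 1` of order prime to `p` INSIDE the subgroup `N = ⟨p-elements⟩`
  (if `N` is a `p`-group it is the normal Sylow `p`-subgroup: `hasNormalSylow_of_isPGroup_closure'`, the (⇐) half of
  ✓`NormalSylow.stub_hasNormalSylow_iff`, re-derived here because that module has no farm build at present);
* `det_eq_one_of_pow_prime_pow_eq_one`, `det_eq_one_of_mem_closure_pElements` — in a linear representation over
  a field of characteristic `p`, `p`-elements have determinant `1` (`x^{pⁿ} = 1 ⇒ x = 1`), hence so has every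
  element of `N`;
* `eq_one_of_sq_eq_zero` — an endomorphism `f` with `(f − 1)² = 0` and `f ^ e = 1`, `p ∤ e`, is the identity;
* `two_le_finrank_range_sub_one` — **a determinant-one endomorphism `f ≠ 1` which is not unipotent of level 2 moves
  a subspace of dimension ≥ 2**: `2 ≤ dim (f − 1)(V)` (if `(f − 1)(V)` is a line `κu`, either `(f − 1)u = 0`, so
  `(f − 1)² = 0`, or `V = ker (f − 1) ⊕ κu` and `det f = 1 + μ ≠ 1`);
* `exists_tame_two_le_finrank` — the combination: for a representation `φ : I → GL(V)` of a finite NON-p-closed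
  group over a field of characteristic `p` on which the elements of order prime to `p` act faithfully, there is a
  `t ∈ ⟨p-elements⟩ ≤ I` of order prime to `p` with `dim (φ t − 1)(V) ≥ 2`. Read on the cotangent representation of
  an inertia group (tame elements act faithfully on `𝔪/𝔪²`, ✓`TameAutomorphismCotangent`): at every non-p-closed
  point some tame element of `O^{p′}(I_x)` has fixed locus of codimension `≥ 2` — a tame centre through `x` is
  always available (evidence memo PHASE0-TAME-CENTRE-ORDER.md (E3) on the item).

[OURS · crux stmt-ResolutionOfSingularities-15640 · helper toward `stub_phaseZeroHighDim`; folklore group theory /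
linear algebra, counted 0; AI-level work, weaker than expert review.] [folklore]
-/

-- single-problem summit: the doubled namespace component `ResolutionOfSingularities` is forced
set_option linter.dupNamespace false

namespace Summit.ResolutionOfSingularities.ResolutionOfSingularities.Theorems.WildQuotientResolution.NpcTameElement

open Literature.AlgebraicGeometry.Ramification

/-! ## Group theory: a tame element inside `⟨p-elements⟩` -/

section Group

variable {p : ℕ} [hp : Fact p.Prime] {H : Type*} [Group H] [Finite H]

/-- A finite group which is not a `p`-group has an element `≠ 1` of order prime to `p`
(`g ^ (p ^ v_p(ord g))` for `g` of order not a power of `p`). [folklore] -/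
theorem exists_ne_one_coprime_of_not_isPGroup (h : ¬ IsPGroup p H) :
    ∃ t : H, t ≠ 1 ∧ (orderOf t).Coprime p := by
  simp only [IsPGroup, not_forall, not_exists] at h
  obtain ⟨g, hg⟩ := h
  refine ⟨g ^ p ^ (orderOf g).factorization p, ?_, ?_⟩
  · exact hg _
  · have hn : orderOf g ≠ 0 := (orderOf_pos g).ne'
    rw [orderOf_pow' g (pow_ne_zero _ hp.out.ne_zero),
      Nat.gcd_eq_right (Nat.ordProj_dvd (orderOf g) p)]
    exact (Nat.coprime_ordCompl hp.out hn).symm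

omit hp in
/-- The subgroup `⟨p-elements⟩` is normal (the generating set is closed under conjugation). [folklore] -/
-- adapted from ✓`NormalSylow.normal_closure_pElements` (Theorems/…StubHasNormalSylowIff.lean, no farm build)
theorem normal_closure_pElements' {G : Type*} [Group G] :
    (Subgroup.closure {g : G | ∃ n : ℕ, g ^ p ^ n = 1}).Normal := by
  refine ⟨fun x hx g => ?_⟩
  induction hx using Subgroup.closure_induction with
  | mem y hy =>
    obtain ⟨n, hn⟩ := hy
    exact Subgroup.subset_closure ⟨n, by rw [conj_pow, hn, mul_one, mul_inv_cancel]⟩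
  | one =>
    rw [mul_one, mul_inv_cancel]
    exact Subgroup.one_mem _
  | mul y z _ _ hy hz =>
    have e : g * (y * z) * g⁻¹ = (g * y * g⁻¹) * (g * z * g⁻¹) := by group
    rw [e]
    exact Subgroup.mul_mem _ hy hz
  | inv y _ hy =>
    have e : g * y⁻¹ * g⁻¹ = (g * y * g⁻¹)⁻¹ := by group
    rw [e]
    exact Subgroup.inv_mem _ hy

omit hp in
/-- If `⟨p-elements⟩` is a `p`-group then the group is p-closed: a Sylow `p`-subgroup containing it consists of
`p`-elements, hence equals this normal subgroup. [folklore] -/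
-- adapted from ✓`NormalSylow.hasNormalSylow_of_isPGroup_closure` (no farm build)
theorem hasNormalSylow_of_isPGroup_closure' {G : Type*} [Group G]
    (h : IsPGroup p (Subgroup.closure {g : G | ∃ n : ℕ, g ^ p ^ n = 1})) : HasNormalSylow p G := by
  obtain ⟨P, hP⟩ := h.exists_le_sylow
  have hle : (P : Subgroup G) ≤ Subgroup.closure {g : G | ∃ n : ℕ, g ^ p ^ n = 1} := by
    intro g hg
    apply Subgroup.subset_closure
    obtain ⟨k, hk⟩ := P.isPGroup' ⟨g, hg⟩
    exact ⟨k, by simpa using congrArg Subtype.val hk⟩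
  have heq : (P : Subgroup G) = Subgroup.closure {g : G | ∃ n : ℕ, g ^ p ^ n = 1} := le_antisymm hle hP
  exact ⟨P, heq ▸ normal_closure_pElements'⟩

/-- **In a non-p-closed finite group the subgroup generated by the `p`-elements contains an element `≠ 1` of order
prime to `p`.** [folklore] -/
theorem exists_tame_mem_closure_pElements {I : Type*} [Group I] [Finite I] (hI : ¬ HasNormalSylow p I) :
    ∃ t ∈ Subgroup.closure {g : I | ∃ n : ℕ, g ^ p ^ n = 1}, t ≠ 1 ∧ (orderOf t).Coprime p := by
  have hN : ¬ IsPGroup p (Subgroup.closure {g : I | ∃ n : ℕ, g ^ p ^ n = 1}) :=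
    fun h => hI (hasNormalSylow_of_isPGroup_closure' h)
  obtain ⟨t, ht1, htc⟩ := exists_ne_one_coprime_of_not_isPGroup hN
  refine ⟨t, t.2, fun h => ht1 (Subtype.ext h), ?_⟩
  rwa [← Subgroup.orderOf_coe t] at htc

end Group

/-! ## Linear algebra: `p`-elements have determinant one; determinant-one tame elements are not pseudo-reflections -/

section Linear

variable {κ : Type*} [Field κ] {V : Type*} [AddCommGroup V] [Module κ V] [FiniteDimensional κ V]

omit [FiniteDimensional κ V] in
/-- Over a field of characteristic `p`, an automorphism with `f ^ (p ^ n) = 1` has determinant `1`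
(`x ^ (p ^ n) = 1 ⇒ (x − 1) ^ (p ^ n) = 0 ⇒ x = 1`). [folklore] -/
theorem det_eq_one_of_pow_prime_pow_eq_one (p : ℕ) [Fact p.Prime] [CharP κ p] (f : V ≃ₗ[κ] V) {n : ℕ}
    (hf : f ^ p ^ n = 1) : LinearEquiv.det f = 1 := by
  have h1 : (LinearEquiv.det f) ^ p ^ n = 1 := by rw [← map_pow, hf, map_one]
  have h2 : ((LinearEquiv.det f : κ) - 1) ^ p ^ n = 0 := by
    rw [sub_pow_char_pow, one_pow, ← Units.val_pow_eq_pow_val, h1, Units.val_one, sub_self]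
  have h3 : (LinearEquiv.det f : κ) = 1 := sub_eq_zero.mp (pow_eq_zero_iff (pow_ne_zero _
    (Fact.out : p.Prime).ne_zero) |>.mp h2)
  exact Units.ext h3

omit [FiniteDimensional κ V] in
/-- Hence every element of the subgroup generated by the `p`-elements of a linear group has determinant `1`.
[folklore] -/
theorem det_eq_one_of_mem_closure_pElements (p : ℕ) [Fact p.Prime] [CharP κ p] {I : Type*} [Group I]
    (φ : I →* (V ≃ₗ[κ] V)) {t : I} (ht : t ∈ Subgroup.closure {g : I | ∃ n : ℕ, g ^ p ^ n = 1}) :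
    LinearEquiv.det (φ t) = 1 := by
  have hle : Subgroup.closure {g : I | ∃ n : ℕ, g ^ p ^ n = 1} ≤ (LinearEquiv.det.comp φ).ker := by
    rw [Subgroup.closure_le]
    rintro g ⟨n, hn⟩
    rw [SetLike.mem_coe, MonoidHom.mem_ker, MonoidHom.comp_apply]
    exact det_eq_one_of_pow_prime_pow_eq_one p (φ g) (n := n) (by rw [← map_pow, hn, map_one])
  exact hle ht

omit [FiniteDimensional κ V] in
/-- An endomorphism with `(f − 1)² = 0` and `f ^ e = 1` for some `e` prime to the characteristic `p` is the
identity: `f ^ p = 1` (binomial theorem in characteristic `p`), so `f = f ^ gcd(e, p) = 1`. [folklore] -/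
theorem eq_one_of_sq_eq_zero (p : ℕ) [Fact p.Prime] [CharP κ p] (f : Module.End κ V)
    (hN : (f - 1) ^ 2 = 0) {e : ℕ} (he : f ^ e = 1) (hep : e.Coprime p) : f = 1 := by
  have hp : p.Prime := Fact.out
  rcases subsingleton_or_nontrivial V with hV | hV
  · haveI : Subsingleton (Module.End κ V) := inferInstance
    exact Subsingleton.elim _ _
  haveI : Nontrivial (Module.End κ V) := inferInstance
  haveI : CharP (Module.End κ V) p :=
    charP_of_injective_algebraMap (algebraMap κ (Module.End κ V)).injective p
  have hNp : (f - 1) ^ p = 0 := by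
    have h2 : 2 ≤ p := hp.two_le
    obtain ⟨k, hk⟩ := Nat.exists_eq_add_of_le h2
    rw [hk, pow_add, hN, zero_mul]
  have hfp : f ^ p = 1 := by
    have hc : Commute (f - 1) (1 : Module.End κ V) := Commute.one_right _
    have e1 : f = (f - 1) + 1 := by abel
    rw [e1, add_pow_char_of_commute (p := p) hc, hNp, one_pow, zero_add]
  have hg : f ^ Nat.gcd e p = 1 := pow_gcd_eq_one.mpr ⟨he, hfp⟩
  rwa [Nat.Coprime.gcd_eq_one hep, pow_one] at hg

/-- The determinant of an endomorphism acting as the identity on `W` and as the scalar `c` on a complementary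
line `κu`. [folklore] -/
theorem det_eq_of_isCompl_line (f : Module.End κ V) (W : Submodule κ V) {u : V} (hu : u ≠ 0)
    (h : IsCompl W (κ ∙ u)) (hW : ∀ w ∈ W, f w = w) {c : κ} (hfu : f u = c • u) :
    LinearMap.det f = c := by
  classical
  set U : Submodule κ V := κ ∙ u with hU
  let e : (W × U) ≃ₗ[κ] V := Submodule.prodEquivOfIsCompl W U h
  -- `f` restricted to `U` is `c • id`
  have hfU : ∀ x ∈ U, f x = c • x := by
    intro x hx
    obtain ⟨a, rfl⟩ := Submodule.mem_span_singleton.mp hx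
    rw [map_smul, hfu, smul_comm]
  -- `e⁻¹ ∘ f ∘ e = id × (c • id)`
  have hconj : (e.symm : V →ₗ[κ] W × U) ∘ₗ f ∘ₗ (e : W × U →ₗ[κ] V) =
      LinearMap.prodMap LinearMap.id (c • LinearMap.id) := by
    apply LinearMap.ext
    rintro ⟨w, x⟩
    have h1 : f (e (w, x)) = e (w, c • x) := by
      simp only [e, Submodule.coe_prodEquivOfIsCompl', map_add, Submodule.coe_smul]
      rw [hW w w.2, hfU x x.2]
    simp only [LinearMap.coe_comp, LinearEquiv.coe_coe, Function.comp_apply, h1,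
      LinearEquiv.symm_apply_apply, LinearMap.prodMap_apply, LinearMap.id_coe, id_eq,
      LinearMap.smul_apply]
  have hdet : LinearMap.det f =
      LinearMap.det ((e.symm : V →ₗ[κ] W × U) ∘ₗ f ∘ₗ (e : W × U →ₗ[κ] V)) := by
    rw [← LinearMap.det_conj f e.symm]
    rfl
  rw [hdet, hconj, LinearMap.det_prodMap, LinearMap.det_id, one_mul, LinearMap.det_smul,
    LinearMap.det_id, mul_one, finrank_span_singleton hu, pow_one]

/-- **A determinant-one endomorphism which is neither the identity nor unipotent of level `2` moves a subspace
of dimension at least `2`.** If `f ≠ 1`, `det f = 1` and `(f − 1)² = 0 ⇒ f = 1`, then `2 ≤ dim (f − 1)(V)`: were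
`(f − 1)(V)` a line `κu`, either `(f − 1)u = 0` and `(f − 1)² = 0`, or `V = ker(f − 1) ⊕ κu` with
`f u = (1 + μ)u`, `μ ≠ 0`, and `det f = 1 + μ ≠ 1`. [folklore] -/
theorem two_le_finrank_range_sub_one (f : Module.End κ V) (hf1 : f ≠ 1)
    (hdet : LinearMap.det f = 1) (hss : (f - 1) ^ 2 = 0 → f = 1) :
    2 ≤ Module.finrank κ (LinearMap.range (f - 1)) := by
  classical
  set N := f - 1 with hNdef
  by_contra hlt
  rw [not_le] at hlt
  have hle : Module.finrank κ (LinearMap.range N) ≤ 1 := by omega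
  -- `range N ≠ 0` since `f ≠ 1`
  have hN0 : N ≠ 0 := fun h => hf1 (sub_eq_zero.mp h)
  have hpos : 0 < Module.finrank κ (LinearMap.range N) := by
    rw [Module.finrank_pos_iff_exists_ne_zero]
    obtain ⟨v, hv⟩ : ∃ v, N v ≠ 0 := by
      by_contra h
      exact hN0 (LinearMap.ext fun v => not_not.mp (not_exists.mp h v))
    exact ⟨⟨N v, LinearMap.mem_range_self N v⟩, fun h => hv (congrArg Subtype.val h)⟩
  have h1 : Module.finrank κ (LinearMap.range N) = 1 := le_antisymm hle hpos
  -- the line `range N = κ u`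
  obtain ⟨u, hu, hUeq⟩ : ∃ u : V, u ≠ 0 ∧ LinearMap.range N = κ ∙ u := by
    obtain ⟨u', hu'⟩ := finrank_eq_one_iff'.mp h1
    refine ⟨(u' : V), fun h => hu'.1 (Subtype.ext h), ?_⟩
    apply le_antisymm
    · intro v hv
      obtain ⟨c, hc⟩ := hu'.2 ⟨v, hv⟩
      exact Submodule.mem_span_singleton.mpr ⟨c, by simpa using congrArg Subtype.val hc⟩
    · rw [Submodule.span_singleton_le_iff_mem]
      exact u'.2
  have hNu_mem : N u ∈ κ ∙ u := by rw [← hUeq]; exact LinearMap.mem_range_self N u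
  obtain ⟨μ, hμ⟩ := Submodule.mem_span_singleton.mp hNu_mem
  by_cases hμ0 : μ = 0
  · -- `N u = 0`: then `N² = 0`
    have hNu : N u = 0 := by rw [← hμ, hμ0, zero_smul]
    apply hf1
    apply hss
    rw [pow_two]
    apply LinearMap.ext
    intro v
    have hv : N v ∈ κ ∙ u := by rw [← hUeq]; exact LinearMap.mem_range_self N v
    obtain ⟨a, ha⟩ := Submodule.mem_span_singleton.mp hv
    change N (N v) = 0
    rw [← ha, map_smul, hNu, smul_zero]
  · -- `N u = μ u`, `μ ≠ 0`: `V = ker N ⊕ κ u` and `det f = 1 + μ`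
    set W := LinearMap.ker N with hW
    have huW : u ∉ W := by
      intro h
      rw [hW, LinearMap.mem_ker, ← hμ] at h
      exact hμ0 (smul_eq_zero.mp h |>.resolve_right hu)
    have hinf : W ⊓ (κ ∙ u) = ⊥ := by
      rw [eq_bot_iff]
      intro v hv
      obtain ⟨hvW, hvU⟩ := Submodule.mem_inf.mp hv
      obtain ⟨a, rfl⟩ := Submodule.mem_span_singleton.mp hvU
      by_cases ha : a = 0
      · rw [ha, zero_smul]; exact Submodule.zero_mem _
      · exact absurd (by simpa [Submodule.smul_mem_iff _ ha] using hvW) huW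
    have hcompl : IsCompl W (κ ∙ u) := by
      refine IsCompl.of_eq hinf ?_
      have hsum := Submodule.finrank_sup_add_finrank_inf_eq W (κ ∙ u)
      rw [hinf, finrank_bot, add_zero, finrank_span_singleton hu] at hsum
      have hrn := LinearMap.finrank_range_add_finrank_ker N
      rw [h1, ← hW] at hrn
      apply Submodule.eq_top_of_finrank_eq
      rw [hsum]
      omega
    have hWf : ∀ w ∈ W, f w = w := by
      intro w hw
      rw [hW, LinearMap.mem_ker] at hw
      have : f w - w = 0 := by simpa [hNdef] using hw
      exact sub_eq_zero.mp this
    have hfu : f u = (1 + μ) • u := by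
      have : f u - u = μ • u := by simpa [hNdef] using hμ.symm
      rw [add_smul, one_smul, ← this]; abel
    have hd := det_eq_of_isCompl_line f W hu hcompl hWf hfu
    rw [hdet] at hd
    exact hμ0 (by simpa using hd.symm)

/-- **Tame elements of fixed-locus codimension ≥ 2 exist in non-p-closed linear groups.** Let `φ : I → GL(V)` be a
representation of a finite NON-p-closed group over a field of characteristic `p`, such that the elements of order
prime to `p` act faithfully. Then some `t ∈ ⟨p-elements of I⟩`, of order prime to `p`, moves a subspace of
dimension `≥ 2`: `2 ≤ dim (φ t − 1)(V)` — its fixed subspace has codimension `≥ 2`. On the cotangent representation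
of a non-p-closed inertia group: a tame element whose fixed locus is a legitimate (codimension `≥ 2`) centre.
[folklore] -/
theorem exists_tame_two_le_finrank (p : ℕ) [Fact p.Prime] [CharP κ p] {I : Type*} [Group I] [Finite I]
    (φ : I →* (V ≃ₗ[κ] V)) (hfaith : ∀ t : I, (orderOf t).Coprime p → φ t = 1 → t = 1)
    (hI : ¬ HasNormalSylow p I) :
    ∃ t ∈ Subgroup.closure {g : I | ∃ n : ℕ, g ^ p ^ n = 1}, (orderOf t).Coprime p ∧ t ≠ 1 ∧
      2 ≤ Module.finrank κ (LinearMap.range ((φ t : V →ₗ[κ] V) - 1)) := by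
  obtain ⟨t, htN, ht1, htc⟩ := exists_tame_mem_closure_pElements (p := p) hI
  refine ⟨t, htN, htc, ht1, ?_⟩
  have hdet1 : LinearMap.det ((φ t : V →ₗ[κ] V)) = 1 := by
    rw [← LinearEquiv.coe_det, det_eq_one_of_mem_closure_pElements p φ htN, Units.val_one]
  have hft1 : (φ t : V →ₗ[κ] V) ≠ 1 := by
    intro h
    apply ht1
    apply hfaith t htc
    apply LinearEquiv.toLinearMap_injective
    rw [h]
    rfl
  refine two_le_finrank_range_sub_one _ hft1 hdet1 fun hsq => ?_
  -- `(φ t − 1)² = 0` and `(φ t) ^ ord t = 1` with `ord t` prime to `p` force `φ t = 1`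
  have hpow : ((φ t : V →ₗ[κ] V)) ^ orderOf t = 1 := by
    have h0 : φ t ^ orderOf t = 1 := by rw [← map_pow, pow_orderOf_eq_one, map_one]
    have h1 := congrArg (LinearEquiv.automorphismGroup.toLinearMapMonoidHom (R := κ) (M := V)) h0
    rw [map_pow, map_one] at h1
    exact h1
  exact eq_one_of_sq_eq_zero p _ hsq hpow htc

end Linear

end Summit.ResolutionOfSingularities.ResolutionOfSingularities.Theorems.WildQuotientResolution.NpcTameElement
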